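import Summits.PneNP.PneNP.Theorems.SymmetryBudgetWindowBarrierEntropyGameTransfer
import Summits.PneNP.PneNP.Theorems.SymmetryBudgetWindowBarrierEntropyGameTransferEntropy
import Summits.PneNP.PneNP.Theorems.SymmetryBudgetWindowBarrierEntropyGameColouringTypes

/-!
# Transfer lemma: type-entropy of the simulating colouring; the orbit-refinement corollary (D″ under TAME)

Route `PneNP/SymmetryBudget`, dichotomy `WindowBarrier` (stmt-PneNP-2145) / `NoHiddenOrder`
(stmt-PneNP-14781). Assembles `…EntropyGameTransfer.lean` (a conflict-free colouring simulates an
individualisation–refinement path; the reverse greedy colouring has colours `≤ |class|`) with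
`…EntropyGameTransferEntropy.lean` (coloured multinomial inequality) in the vocabulary of the entropy
game (`CosetGame.classStab`, `CosetGame.IsLowEntropy`):

* `Refinement.exists_colouring_transfer`: for every refinement operator `R` on `Fin n` and every
  injective point sequence `v₀,…,v_{t-1}` there is a colouring `c` with `R (ker c) ≤ P_t` (it reaches the
  end of the I/R path) and `n! ≤ 2^{n+t} · (∏_{j<t} |P_j-class of v_j|)² · |classStab c|` — TYPE entropy
  `≤ n + t + 2·I` where `I = ∑_j log₂ |class_j|` is the classical information cost of the path. So the
  flatness cost of individualisation–refinement is the classical I/R path cost up to `O(n)`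
  (this REPLACES the pessimistic accounting "log₂ n per individualised point" of the seat's memo
  ENTROPY-GAME.md Addendum 6: D′ ⇒ D″).
* `orbitRefinement A` (`A ≤ Sym(n)`): `s ↦` orbits of the subgroup of `A` preserving every class of
  `s` — the refinement an orbit-complete ("TAME") procedure computes for `A = Aut W`. Along any path its
  classes are orbits of point stabilisers, so `∏_j |class_j| ≤ |A|` (orbit–stabiliser), whence
  `exists_distinguishing_lowEntropy`: **every permutation group `A` on `n` points has a colouring `c`
  with `A ⊓ classStab c = ⊥` and `n! ≤ 2^{2n} · |A|² · |classStab c|`** — entropy `≤ 2n + 2 log₂|A|`;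
  `log₂|A|` is necessary (`card_mul_card_classStab_le_factorial`). With `A = Aut W` this is
  Conjecture D″ of the memo ("single-type discretisation at entropy `O(n) + O(log₂|Aut W|)`") for any
  refinement that reaches `Aut`-orbits on pointed structures.
-/

-- `Summit.PneNP.PneNP.…` duplicates `PneNP` BY DESIGN (single-problem summit, D-0017).
set_option linter.dupNamespace false

namespace Summit.PneNP.PneNP.Theorems.CosetGame

open Finset Equiv
open scoped Classical

noncomputable section

namespace Refinement

variable {n : ℕ} (ρ : Refinement (Fin n)) {v : ℕ → Fin n} {t : ℕ}

/-- The `P_j`-class of `v_j`, as a finset. -/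
def cls (v : ℕ → Fin n) (j : ℕ) : Finset (Fin n) := univ.filter fun x => ρ.path v j (v j) x

/-- Membership in `cls`. -/
theorem mem_cls {v : ℕ → Fin n} {j : ℕ} {x : Fin n} : x ∈ ρ.cls v j ↔ ρ.path v j (v j) x := by
  unfold cls; rw [mem_filter]; exact ⟨fun h => h.2, fun h => ⟨mem_univ _, h⟩⟩

/-- The support of the greedy colouring is the set of path points. -/
theorem filter_greedyColouring_ne_zero (hinj : ∀ i j, i < t → j < t → v i = v j → i = j) :
    (univ.filter fun u => ρ.greedyColouring v t u ≠ 0) = (range t).image v := by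
  ext u
  rw [mem_filter, mem_image]
  constructor
  · rintro ⟨-, hu⟩
    by_contra h
    push Not at h
    exact hu (ρ.greedyColouring_eq_zero fun j hj huj => h j (mem_range.2 hj) huj.symm)
  · rintro ⟨j, hj, rfl⟩
    refine ⟨mem_univ _, ?_⟩
    rw [ρ.greedyColouring_apply hinj (mem_range.1 hj)]
    exact (ρ.greedy_pos v t (mem_range.1 hj)).ne'

/-- **Type entropy of the greedy colouring**: `n! ≤ 2^{n+t} · (∏_{j<t} |class_j|)² · |classStab c|`. -/
theorem factorial_le_greedyColouring (hinj : ∀ i j, i < t → j < t → v i = v j → i = j) :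
    n.factorial ≤ 2 ^ (n + t) * (∏ j ∈ range t, (ρ.cls v j).card) ^ 2 *
      Nat.card (classStab (ρ.greedyColouring v t)) := by
  set c := ρ.greedyColouring v t with hc
  have h0 := factorial_le_coloured_univ c
  rw [Fintype.card_fin, ← card_classStab c, ρ.filter_greedyColouring_ne_zero hinj] at h0
  have hinjOn : Set.InjOn v (range t : Set ℕ) := fun i hi j hj h =>
    hinj i j (mem_range.1 (mem_coe.1 hi)) (mem_range.1 (mem_coe.1 hj)) h
  rw [prod_image hinjOn] at h0
  -- bound each colour by the class size
  have hX : ∏ j ∈ range t, 2 * c (v j) ^ 2 ≤ 2 ^ t * (∏ j ∈ range t, (ρ.cls v j).card) ^ 2 := by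
    calc ∏ j ∈ range t, 2 * c (v j) ^ 2 ≤ ∏ j ∈ range t, 2 * (ρ.cls v j).card ^ 2 := by
          refine prod_le_prod' fun j hj => Nat.mul_le_mul_left _ (Nat.pow_le_pow_left ?_ 2)
          exact ρ.greedyColouring_le_card_class hinj (mem_range.1 hj)
      _ = 2 ^ t * (∏ j ∈ range t, (ρ.cls v j).card) ^ 2 := by
          rw [prod_mul_distrib, prod_const, card_range, prod_pow]
  calc n.factorial ≤ 2 ^ n * (∏ j ∈ range t, 2 * c (v j) ^ 2) * Nat.card (classStab c) := h0
    _ ≤ 2 ^ n * (2 ^ t * (∏ j ∈ range t, (ρ.cls v j).card) ^ 2) * Nat.card (classStab c) :=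
        Nat.mul_le_mul_right _ (Nat.mul_le_mul_left _ hX)
    _ = _ := by rw [pow_add]; ring

/-- **Transfer lemma, entropy form.** For every refinement operator on `Fin n` and every injective
point sequence there is ONE colouring `c` whose refinement reaches the end of the I/R path,
`R (ker c) ≤ P_t`, of type entropy `n! ≤ 2^{n+t}·(∏_{j<t}|class_j|)²·|classStab c|`
(i.e. `≤ n + t + 2 ∑_j log₂|class_j|` bits). -/
theorem exists_colouring_transfer (hinj : ∀ i j, i < t → j < t → v i = v j → i = j) :
    ∃ c : Fin n → ℕ, ρ.R (Setoid.ker c) ≤ ρ.path v t ∧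
      n.factorial ≤ 2 ^ (n + t) * (∏ j ∈ range t, (ρ.cls v j).card) ^ 2 * Nat.card (classStab c) :=
  ⟨ρ.greedyColouring v t, ρ.transfer (ρ.conflictFree_greedyColouring hinj),
    ρ.factorial_le_greedyColouring hinj⟩

/-- Entropy-`K` packaging: if `2^{n+t}·(∏_j |class_j|)² ≤ 2^{Kn}` the simulating colouring is a
legal type of the entropy-`K` game. -/
theorem exists_lowEntropy_transfer {K : ℕ} (hinj : ∀ i j, i < t → j < t → v i = v j → i = j)
    (hK : 2 ^ (n + t) * (∏ j ∈ range t, (ρ.cls v j).card) ^ 2 ≤ 2 ^ (K * n)) :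
    ∃ c : Fin n → ℕ, ρ.R (Setoid.ker c) ≤ ρ.path v t ∧ IsLowEntropy K c := by
  obtain ⟨c, hc, hent⟩ := ρ.exists_colouring_transfer hinj
  refine ⟨c, hc, ?_⟩
  rw [isLowEntropy_iff_card_classStab]
  exact hent.trans (Nat.mul_le_mul_right _ hK)

end Refinement

/-! ### The orbit refinement of a permutation group -/

variable {n : ℕ}

/-- The elements of `A` preserving every class of `s`. -/
def stabSet (A : Subgroup (Perm (Fin n))) (s : Setoid (Fin n)) : Subgroup (Perm (Fin n)) where
  carrier := {a | a ∈ A ∧ ∀ z, s (a z) z}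
  mul_mem' {a b} ha hb := ⟨A.mul_mem ha.1 hb.1, fun z => by
    rw [Perm.mul_apply]; exact s.trans' (ha.2 (b z)) (hb.2 z)⟩
  one_mem' := ⟨A.one_mem, fun z => s.refl' z⟩
  inv_mem' {a} ha := ⟨A.inv_mem ha.1, fun z => by
    have h := ha.2 (a⁻¹ z)
    have e : a (a⁻¹ z) = z := a.apply_symm_apply z
    rw [e] at h
    exact s.symm' h⟩

/-- Membership in `stabSet`. -/
theorem mem_stabSet {A : Subgroup (Perm (Fin n))} {s : Setoid (Fin n)} {a : Perm (Fin n)} :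
    a ∈ stabSet A s ↔ a ∈ A ∧ ∀ z, s (a z) z := Iff.rfl

/-- `stabSet A` is monotone in the relation. -/
theorem stabSet_mono (A : Subgroup (Perm (Fin n))) {s s' : Setoid (Fin n)} (h : s ≤ s') :
    stabSet A s ≤ stabSet A s' := fun _ ha => ⟨ha.1, fun z => h (ha.2 z)⟩

/-- The orbit relation of `stabSet A s`. -/
def orbitSetoidOf (A : Subgroup (Perm (Fin n))) (s : Setoid (Fin n)) : Setoid (Fin n) where
  r x y := ∃ a ∈ stabSet A s, a x = y
  iseqv :=
    ⟨fun x => ⟨1, (stabSet A s).one_mem, rfl⟩,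
      fun {x y} ⟨a, ha, hxy⟩ => ⟨a⁻¹, (stabSet A s).inv_mem ha, by rw [← hxy]; exact a.symm_apply_apply x⟩,
      fun {x y z} ⟨a, ha, hxy⟩ ⟨b, hb, hyz⟩ =>
        ⟨b * a, (stabSet A s).mul_mem hb ha, by rw [Perm.mul_apply, hxy, hyz]⟩⟩

/-- Unfolding `orbitSetoidOf`. -/
theorem orbitSetoidOf_apply {A : Subgroup (Perm (Fin n))} {s : Setoid (Fin n)} {x y : Fin n} :
    orbitSetoidOf A s x y ↔ ∃ a ∈ stabSet A s, a x = y := Iff.rfl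

/-- Orbits of the class stabiliser lie inside classes. -/
theorem orbitSetoidOf_le (A : Subgroup (Perm (Fin n))) (s : Setoid (Fin n)) : orbitSetoidOf A s ≤ s := by
  rintro x y ⟨a, ha, rfl⟩
  exact s.symm' (ha.2 x)

/-- The class stabiliser is unchanged by passing to orbits: `stabSet A (orbits of stabSet A s) = stabSet A s`. -/
theorem stabSet_orbitSetoidOf (A : Subgroup (Perm (Fin n))) (s : Setoid (Fin n)) :
    stabSet A (orbitSetoidOf A s) = stabSet A s := by
  ext a
  constructor
  · exact fun ha => ⟨ha.1, fun z => orbitSetoidOf_le A s (ha.2 z)⟩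
  · exact fun ha => ⟨ha.1, fun z => ⟨a⁻¹, (stabSet A s).inv_mem ha, a.symm_apply_apply z⟩⟩

/-- **The orbit refinement of `A ≤ Sym(n)`**: `s ↦` the orbit relation of the subgroup of `A`
preserving every class of `s`. This is the refinement an orbit-complete procedure computes
(for `A = Aut W`: the vertex partition of any refinement that distinguishes all non-isomorphic
pointed structures). -/
def orbitRefinement (A : Subgroup (Perm (Fin n))) : Refinement (Fin n) where
  R := orbitSetoidOf A
  le_self := orbitSetoidOf_le A
  mono s s' h := by
    rintro x y ⟨a, ha, rfl⟩
    exact ⟨a, stabSet_mono A h ha, rfl⟩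
  idem s := by
    ext x y
    rw [orbitSetoidOf_apply, orbitSetoidOf_apply, stabSet_orbitSetoidOf]

/-- The pointwise stabiliser in `A` of the first `j` path points. -/
def pointStab (A : Subgroup (Perm (Fin n))) (v : ℕ → Fin n) (j : ℕ) : Subgroup (Perm (Fin n)) where
  carrier := {a | a ∈ A ∧ ∀ i < j, a (v i) = v i}
  mul_mem' {a b} ha hb := ⟨A.mul_mem ha.1 hb.1, fun i hi => by rw [Perm.mul_apply, hb.2 i hi, ha.2 i hi]⟩
  one_mem' := ⟨A.one_mem, fun i _ => rfl⟩
  inv_mem' {a} ha := ⟨A.inv_mem ha.1, fun i hi => by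
    conv_lhs => rw [← ha.2 i hi]
    exact a.symm_apply_apply _⟩

/-- Membership in `pointStab`. -/
theorem mem_pointStab {A : Subgroup (Perm (Fin n))} {v : ℕ → Fin n} {j : ℕ} {a : Perm (Fin n)} :
    a ∈ pointStab A v j ↔ a ∈ A ∧ ∀ i < j, a (v i) = v i := Iff.rfl

/-- Preserving the classes of `s ⊓ sep w` = preserving the classes of `s` and fixing `w`. -/
theorem stabSet_sepSetoid_iff {A : Subgroup (Perm (Fin n))} {s : Setoid (Fin n)} {w : Fin n}
    {a : Perm (Fin n)} : a ∈ stabSet A (s ⊓ sepSetoid w) ↔ a ∈ stabSet A s ∧ a w = w := by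
  constructor
  · intro ha
    refine ⟨⟨ha.1, fun z => (ha.2 z).1⟩, ?_⟩
    have h : sepSetoid w (a w) w := (ha.2 w).2
    exact h.2 rfl
  · rintro ⟨ha, hw⟩
    refine ⟨ha.1, fun z => ⟨ha.2 z, ?_⟩⟩
    change a z = w ↔ z = w
    constructor
    · intro h; exact a.injective (h.trans hw.symm)
    · intro h; rw [h, hw]

/-- Along the path, the class stabiliser is the pointwise stabiliser of the individualised points. -/
theorem stabSet_path (A : Subgroup (Perm (Fin n))) (v : ℕ → Fin n) :
    ∀ j, stabSet A ((orbitRefinement A).path v j) = pointStab A v j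
  | 0 => by
    change stabSet A (orbitSetoidOf A ⊤) = _
    rw [stabSet_orbitSetoidOf]
    ext a
    exact ⟨fun ha => ⟨ha.1, fun i hi => absurd hi (Nat.not_lt_zero i)⟩, fun ha => ⟨ha.1, fun z => trivial⟩⟩
  | j + 1 => by
    change stabSet A (orbitSetoidOf A ((orbitRefinement A).path v j ⊓ sepSetoid (v j))) = _
    rw [stabSet_orbitSetoidOf]
    ext a
    rw [stabSet_sepSetoid_iff, stabSet_path A v j, mem_pointStab, mem_pointStab]
    constructor
    · rintro ⟨⟨hA, h⟩, hj⟩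
      refine ⟨hA, fun i hi => ?_⟩
      rcases Nat.lt_succ_iff_lt_or_eq.1 hi with hi | rfl
      · exact h i hi
      · exact hj
    · rintro ⟨hA, h⟩
      exact ⟨⟨hA, fun i hi => h i (Nat.lt_succ_of_lt hi)⟩, h j (Nat.lt_succ_self j)⟩

/-- The `P_j`-class of `v_j` is its orbit under the pointwise stabiliser of `v_0,…,v_{j-1}`. -/
theorem mem_cls_orbitRefinement (A : Subgroup (Perm (Fin n))) (v : ℕ → Fin n) (j : ℕ) (x : Fin n) :
    x ∈ (orbitRefinement A).cls v j ↔ ∃ a ∈ pointStab A v j, a (v j) = x := by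
  rw [Refinement.mem_cls]
  -- `path j = R (prev)` with `stabSet A prev = stabSet A (path j) = pointStab A v j`
  have key : ∀ s, stabSet A s = stabSet A (orbitSetoidOf A s) := fun s => (stabSet_orbitSetoidOf A s).symm
  cases j with
  | zero =>
    change orbitSetoidOf A ⊤ (v 0) x ↔ _
    rw [orbitSetoidOf_apply, key, ← stabSet_path A v 0]
    rfl
  | succ j =>
    change orbitSetoidOf A ((orbitRefinement A).path v j ⊓ sepSetoid (v j)) (v (j + 1)) x ↔ _
    rw [orbitSetoidOf_apply, key, ← stabSet_path A v (j + 1)]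
    rfl

/-- **Orbit–stabiliser along the path**: `|pointStab_j| = |class_j| · |pointStab_{j+1}|`. -/
theorem card_pointStab_succ (A : Subgroup (Perm (Fin n))) (v : ℕ → Fin n) (j : ℕ) :
    Nat.card (pointStab A v j) = ((orbitRefinement A).cls v j).card * Nat.card (pointStab A v (j + 1)) := by
  set G := pointStab A v j with hG
  -- orbit–stabiliser for the action of `G` on `Fin n` at the point `v j`
  have horb := MulAction.card_orbit_mul_card_stabilizer_eq_card_group G (v j)
  rw [Nat.card_eq_fintype_card, ← horb]
  congr 1
  · -- the orbit is the class
    rw [← Set.toFinset_card]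
    congr 1
    · ext x
      rw [Set.mem_toFinset, MulAction.mem_orbit_iff, mem_cls_orbitRefinement]
      constructor
      · rintro ⟨⟨a, ha⟩, rfl⟩; exact ⟨a, ha, rfl⟩
      · rintro ⟨a, ha, rfl⟩; exact ⟨⟨a, ha⟩, rfl⟩
  · -- the stabiliser is the next pointwise stabiliser
    rw [Nat.card_eq_fintype_card]
    refine Fintype.card_congr
      { toFun := fun a => ⟨(a.1 : Perm (Fin n)), a.1.2.1, fun i hi => ?_⟩
        invFun := fun a => ⟨⟨a.1, a.2.1, fun i hi => a.2.2 i (Nat.lt_succ_of_lt hi)⟩, ?_⟩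
        left_inv := fun a => by ext; rfl
        right_inv := fun a => by ext; rfl }
    · rcases Nat.lt_succ_iff_lt_or_eq.1 hi with hi | rfl
      · exact a.1.2.2 i hi
      · exact a.2
    · exact a.2.2 j (Nat.lt_succ_self j)

/-- Telescoping: `|A| = (∏_{j<t} |class_j|) · |pointStab_t|`. -/
theorem card_eq_prod_cls_mul (A : Subgroup (Perm (Fin n))) (v : ℕ → Fin n) :
    ∀ t, Nat.card A = (∏ j ∈ range t, ((orbitRefinement A).cls v j).card) * Nat.card (pointStab A v t)
  | 0 => by
    rw [prod_range_zero, one_mul]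
    refine Nat.card_congr (Equiv.subtypeEquivRight fun a => ?_)
    exact ⟨fun ha => ⟨ha, fun i hi => absurd hi (Nat.not_lt_zero i)⟩, fun ha => ha.1⟩
  | t + 1 => by
    rw [card_eq_prod_cls_mul A v t, prod_range_succ, card_pointStab_succ A v t]
    ring

/-- The product of the class sizes along any path is at most `|A|`. -/
theorem prod_cls_le_card (A : Subgroup (Perm (Fin n))) (v : ℕ → Fin n) (t : ℕ) :
    ∏ j ∈ range t, ((orbitRefinement A).cls v j).card ≤ Nat.card A := by
  rw [card_eq_prod_cls_mul A v t]
  exact Nat.le_mul_of_pos_right _ Nat.card_pos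

/-! ### Cheap distinguishing colourings (D″ for orbit-complete refinement) -/

/-- **Every permutation group has a distinguishing colouring of entropy `≤ 2n + 2 log₂|A|`.**
For `A ≤ Sym(n)` there is `c : Fin n → ℕ` with `A ⊓ classStab c = ⊥` (only the identity of `A`
preserves all colour classes) and `n! ≤ 2^{2n}·|A|²·|classStab c|`. Proof: transfer along the
enumeration `0,1,…,n-1` for the orbit refinement of `A`; the class of point `j` is its orbit under
the pointwise stabiliser of `0,…,j-1`, so the product of class sizes is `≤ |A|`, and the path ends
discrete; the simulating colouring is then fixed by no non-identity element of `A`. With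
`A = Aut W` and an orbit-complete flat refinement this is the memo's Conjecture D″. -/
theorem exists_distinguishing_lowEntropy (A : Subgroup (Perm (Fin n))) :
    ∃ c : Fin n → ℕ, (∀ a ∈ A, (∀ u, c (a u) = c u) → a = 1) ∧
      n.factorial ≤ 2 ^ (2 * n) * Nat.card A ^ 2 * Nat.card (classStab c) := by
  rcases Nat.eq_zero_or_pos n with hn | hn
  · subst hn
    refine ⟨fun _ => 0, fun a _ _ => Subsingleton.elim _ _, ?_⟩
    have h1 : 0 < Nat.card A := Nat.card_pos
    have h2 : 0 < Nat.card (classStab fun _ : Fin 0 => (0 : ℕ)) := Nat.card_pos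
    simp only [Nat.factorial_zero, mul_zero, pow_zero, one_mul]
    exact Nat.mul_pos (Nat.pow_pos h1) h2 |> Nat.succ_le_of_lt
  · -- the enumeration of `Fin n`
    set v : ℕ → Fin n := fun j => ⟨j % n, Nat.mod_lt j hn⟩ with hv
    have hvj : ∀ j < n, (v j : ℕ) = j := fun j hj => Nat.mod_eq_of_lt hj
    have hinj : ∀ i j, i < n → j < n → v i = v j → i = j := by
      intro i j hi hj h
      have := congrArg Fin.val h
      rwa [hvj i hi, hvj j hj] at this
    set ρ := orbitRefinement A with hρ
    obtain ⟨c, hc, hent⟩ := ρ.exists_colouring_transfer (t := n) hinj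
    -- the path ends discrete: `pointStab A v n = ⊥`
    have hstab : ∀ a ∈ pointStab A v n, a = 1 := by
      intro a ha
      ext x
      have := ha.2 x.1 x.2
      have hx : v x.1 = x := Fin.ext (hvj x.1 x.2)
      rw [hx] at this
      simp [this]
    have hbot : ρ.path v n = ⊥ := by
      refine le_bot_iff.1 ?_
      intro x y hxy
      -- `path n` is an orbit relation whose acting group has class stabiliser `pointStab A v n`
      have hcls : y ∈ ρ.cls v n ↔ ∃ a ∈ pointStab A v n, a (v n) = y := mem_cls_orbitRefinement A v n y
      -- use the `R`-closedness: `path n = R (path n)`, an orbit relation of `stabSet A (path n) = pointStab`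
      have hR : ρ.path v n = ρ.R (ρ.path v n) := (ρ.R_path v n).symm
      rw [hR] at hxy
      obtain ⟨a, ha, rfl⟩ := hxy
      have ha' : a ∈ pointStab A v n := by rw [← stabSet_path A v n]; exact ha
      rw [hstab a ha']
      rfl
    refine ⟨c, fun a haA hac => ?_, hent.trans ?_⟩
    · -- `a` preserves the classes of `c`, so it acts within `R (ker c) ≤ path n = ⊥`
      have ha : a ∈ stabSet A (Setoid.ker c) := ⟨haA, fun z => hac z⟩
      ext x
      have hrel : ρ.R (Setoid.ker c) x (a x) := ⟨a, ha, rfl⟩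
      have := hc hrel
      rw [hbot] at this
      exact congrArg Fin.val this.symm
    · have hp := prod_cls_le_card A v n
      calc 2 ^ (n + n) * (∏ j ∈ range n, (ρ.cls v j).card) ^ 2 * Nat.card (classStab c)
          ≤ 2 ^ (n + n) * Nat.card A ^ 2 * Nat.card (classStab c) :=
            Nat.mul_le_mul_right _ (Nat.mul_le_mul_left _ (Nat.pow_le_pow_left hp 2))
        _ = 2 ^ (2 * n) * Nat.card A ^ 2 * Nat.card (classStab c) := by rw [two_mul]

/-- Entropy-`K` form: if `2^{2n}|A|² ≤ 2^{Kn}` the distinguishing colouring is a legal type. -/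
theorem exists_distinguishing_isLowEntropy {K : ℕ} (A : Subgroup (Perm (Fin n)))
    (hK : 2 ^ (2 * n) * Nat.card A ^ 2 ≤ 2 ^ (K * n)) :
    ∃ c : Fin n → ℕ, (∀ a ∈ A, (∀ u, c (a u) = c u) → a = 1) ∧ IsLowEntropy K c := by
  obtain ⟨c, hc, hent⟩ := exists_distinguishing_lowEntropy A
  refine ⟨c, hc, ?_⟩
  rw [isLowEntropy_iff_card_classStab]
  exact hent.trans (Nat.mul_le_mul_right _ hK)

/-- **The lower bound `log₂|A|` is necessary**: a distinguishing colouring has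
`|A| · |classStab c| ≤ n!` (the product map `A × classStab c → Sym(n)` is injective). -/
theorem card_mul_card_classStab_le_factorial (A : Subgroup (Perm (Fin n))) (c : Fin n → ℕ)
    (hc : ∀ a ∈ A, (∀ u, c (a u) = c u) → a = 1) :
    Nat.card A * Nat.card (classStab c) ≤ n.factorial := by
  have hinj : Function.Injective fun p : A × classStab c => (p.1 : Perm (Fin n)) * (p.2 : Perm (Fin n)) := by
    rintro ⟨⟨a, ha⟩, ⟨b, hb⟩⟩ ⟨⟨a', ha'⟩, ⟨b', hb'⟩⟩ h
    change a * b = a' * b' at h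
    have h1 : a'⁻¹ * a = b' * b⁻¹ := by
      calc a'⁻¹ * a = a'⁻¹ * (a * b) * b⁻¹ := by group
        _ = a'⁻¹ * (a' * b') * b⁻¹ := by rw [h]
        _ = b' * b⁻¹ := by group
    have hone : a'⁻¹ * a = 1 :=
      hc _ (A.mul_mem (A.inv_mem ha') ha)
        (by rw [h1]; exact (classStab c).mul_mem hb' ((classStab c).inv_mem hb))
    have haa : a = a' := by
      calc a = a' * (a'⁻¹ * a) := by group
        _ = a' := by rw [hone, mul_one]
    have hbb : b = b' := by
      rw [haa] at h
      exact mul_left_cancel h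
    subst haa hbb
    rfl
  have h := Nat.card_le_card_of_injective _ hinj
  have hfin : Nat.card (Fin n) = n := by rw [Nat.card_eq_fintype_card, Fintype.card_fin]
  rw [Nat.card_prod, Nat.card_perm, hfin] at h
  exact h

end

end Summit.PneNP.PneNP.Theorems.CosetGame
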